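import Summits.QuantumAdvantage.QuantumAdvantage.Theorems.RankDialD
import Literature.Computability.MetaComplexity.RazborovSmolenskyPoly
import HarnessLib

/-!
# RankDial (G) — «DegreeDial»: the 𝔽₂-DEGREE grade of a silent window — the first law INSIDE the dead zone of
# every window-only law (decomp-qadv lens-1 «grading / quantitative ladder», generation 26, RESIDUAL MODE on
# `stmt-QuantumAdvantage-23109` via rung R5 = `AdviceFreeQNC0.WalkHardFLinSel p`)

Parts A–F grade a cut-free window `[L, L+ℓ)` of a strategy by WINDOW-ONLY data (number of readers [g24], `𝔽_p`-sketch
dimension [A–D], min-mass [E–F]) and prove that every such law ends at rank fraction `1/(p−1)` (`not_equiRank_block`,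
`not_massRank_block`): the block / Olson sketches determine `|v|` exactly.  This part grades the window by the
**𝔽₂-DEGREE OF THE CUT TESTS** instead: `DegLE y s` :⟺ on every outside fibre `(a,b)` every selector
`v ↦ y_g(a ++ v ++ b)`, read as a function `{0,1}^ℓ → 𝔽₂`, has degree `≤ s` (§14).  Under `LinSel` this holds as soon as
every cut's linear form has WINDOW SUPPORT `≤ s` (`degLE_of_wsupp_le`, via the junta lemma `junta_mem_lowDeg`, §13/§15) —
whatever the rank: the coordinate-reader windows have support `1` and FULL rank `ℓ` (`coordY_not_rankLE`, §16), and the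
block sketches of parts D/F have support `p − 1`.

* §14 **FIBRE THEOREM, degree version (tables ARBITRARY, modulus-free).**  `three_mul_win_fibre_le`: if the supports of
  degree-`≤ s` polynomials are balanced over `|v| mod 3` up to `E`, then on every fibre `3·#WIN ≤ 2·2^ℓ + 3E` — the ONE
  bit of cut structure used is g24's «each firing cut is live at exactly two classes» (`sum_three_classes_le`), applied to
  the class parities `classPar r = Σ_{g live at r} fire_g ∈ lowDeg s`.  With the tree's Viola–Wigderson balance
  (`abs_three_mul_card_class_sub_card_support_le`, error `1 + 2^ℓ e^{−3ℓ/(8·4^s)}`, absorbed by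
  `four_mul_one_add_err_le_two_pow` once `4(s+2)4^s ≤ ℓ`): `twelve_mul_win_fibre_le` (`12·#WIN ≤ 11·2^ℓ`), Fubini
  `window_bound_of_degLE` (`12·#WIN ≤ 11·2ⁿ`), and the PIECE `WindowDegSel` (∀ s ∃ θ < 1 …) **PROVED**: `windowDegSel_holds`
  (`θ = 11/12`, `ℓ₀ = 4(s+2)4^s`; no prime, no linearity).
* §15 **PIECE `WindowJuntaLinSel p`** (LinSel, every cut's window support `≤ s`) **PROVED for every prime `p`**
  (`windowJuntaLinSel_holds`); NECESSARY for R5 (`windowJunta_of_r5`).  The residual piece `WindowWideLinSel p s`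
  (= `WindowHighRankLinSel p` restricted to windows with SOME cut of window support `> s`) is NECESSARY (`wide_of_highRank`)
  and, with the junta law, gives back the high-rank piece (`highRank_of_junta_wide`, `highRank_iff_wide`), so
  `r5_residual_wide : 5 ≤ p → WindowWideLinSel p s → NoWindowLinSel p → WalkHardFLinSel p` for every `s`.
* §16 **STRICTNESS: the junta law lives where no window-only law can.**  The coordinate-reader strategy `coordY ℓ`
  (`n = 2ℓ`, window `[0, ℓ)`, cut `ℓ + i` tests bit `i`, all other cuts silent) is `LinSel` (`coordY_linSel`), has the
  window cut-free (`coordY_cutFree`), window supports `≤ 1` (`coordY_wsupp_le_one`), and sketch dimension `> d` whenever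
  `p^d < 2^ℓ` (`coordY_not_rankLE`: a sketch through which every coordinate factors is injective on the cube) — in
  particular rank `> ℓ/(p−1) ≥` the ceiling of parts D/F for `p ≥ 3` (`coordY_not_rankLE_div`).  So `WindowJuntaLinSel`
  is not implied by `WindowRankLinSel`/`MassRankLin`, and the block sketches that refute `EquiRank`/`MassRank` at
  `ℓ/(p−1)` are junta windows (support `p − 1`), decided here.
* §17 the dial in one line (`degree_dial`) and the conditional √ℓ-rung: an abstract balance hypothesis `ClassBalance s ℓ E`
  with `4E ≤ 2^ℓ` gives the same bound (`twelve_mul_win_fibre_le_of_balance`); Smolensky's correlation bound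
  (`O(s/√ℓ)·2^ℓ`, in print, not in the tree) is typed as `SmolenskyBalance K` and yields the degree law up to
  `s ≤ √ℓ/(4K)`-type profiles (`windowDeg_of_smolensky`) — the typed next rung; general-table death of the degree law at
  `s ≍ √ℓ` (band polynomials computing `|v|` near `ℓ/2`) is recorded in the memo, not claimed here.

HONEST LIMITS.  The junta law is a SUB-CASE of the IDEA-NEEDED piece `WindowHighRankLinSel p` (it does not decide it):
a single cut of wide window support leaves `DegLE` and the residual `WindowWideLinSel p s` is, modulo the proved junta
law, EQUIVALENT to the high-rank piece (`highRank_iff_wide`).  What is new is the lever — 𝔽₂-degree of the cut tests +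
one bit of liveness structure — which is insensitive to rank and to the number of readers, and a kernel theorem in the
regime (rank `> ℓ/(p−1)`) where parts D/F prove every window-only law false.

All statements sorry-free; tables arbitrary unless `LinSel`/`hyl` is an explicit hypothesis.

## References
* [ViolaWigderson2008] E. Viola, A. Wigderson, *Norms, XOR lemmas, and lower bounds for polynomials and protocols*,
  Theory of Computing 4 (2008), Thm 2.9 — in the tree as `GowersCube.violaWigderson_cube_exp_bound`, used through
  `AdviceFreeQNC0.abs_three_mul_card_class_sub_card_support_le`.
* [Smolensky1987] R. Smolensky, *Algebraic methods in the theory of lower bounds for Boolean circuit complexity*, STOC 1987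
  (the `O(s/√ℓ)` correlation bound behind `SmolenskyBalance`; typed, not proved here).
* [Viola2009] E. Viola, *On the power of small-depth computation*, Found. Trends TCS 5 (2009), Ch. 1 (correlation bounds
  for polynomials; the degree-`log n` barrier).
-/

set_option linter.dupNamespace false
set_option autoImplicit false

noncomputable section

open Classical

namespace Summit.QuantumAdvantage.QuantumAdvantage.Theorems.RankDial

open Finset
open Summit.QuantumAdvantage.AdviceFreeQNC0
open Literature.Computability.MetaComplexity Literature.Computability.MetaComplexity.Smolensky

/-! ### §13 Juntas have low degree -/

section Junta
variable {F : Type*} [Field F] {ℓ : ℕ}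

/-- The indicator of one coordinate value, `[v i = β]`, as a cube function. -/
def bitInd (F : Type*) [Field F] (i : Fin ℓ) (β : Bool) : CubeFn F ℓ :=
  fun v => if v i = β then 1 else 0

/-- `[v i = β]` has degree `≤ 1` (`x_i` or `1 − x_i`). -/
theorem bitInd_mem_lowDeg (i : Fin ℓ) (β : Bool) : bitInd F i β ∈ lowDeg F ℓ 1 := by
  have hX : mono F ({i} : Finset (Fin ℓ)) ∈ lowDeg F ℓ 1 := mono_mem_lowDeg (by simp)
  cases β with
  | true =>
    have h : bitInd F i true = mono F ({i} : Finset (Fin ℓ)) := by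
      funext v
      simp [bitInd, mono_apply]
    rw [h]
    exact hX
  | false =>
    have h : bitInd F i false = 1 - mono F ({i} : Finset (Fin ℓ)) := by
      funext v
      by_cases hv : v i = true
      · simp [bitInd, mono_apply, hv]
      · simp [bitInd, mono_apply, hv]
    rw [h]
    exact Submodule.sub_mem _ (one_mem_lowDeg 1) hX

/-- The pattern indicator `[v = w on S]`. -/
def patInd (F : Type*) [Field F] (S : Finset (Fin ℓ)) (w : Fin ℓ → Bool) : CubeFn F ℓ :=
  ∏ i ∈ S, bitInd F i (w i)

/-- pointwise value of the pattern indicator -/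
theorem patInd_apply (S : Finset (Fin ℓ)) (w v : Fin ℓ → Bool) :
    patInd F S w v = if (∀ i ∈ S, v i = w i) then 1 else 0 := by
  unfold patInd
  rw [Finset.prod_apply]
  simp only [bitInd]
  rw [Finset.prod_boole]
  split_ifs <;> rfl

/-- `[v = w on S]` has degree `≤ #S`. -/
theorem patInd_mem_lowDeg (S : Finset (Fin ℓ)) (w : Fin ℓ → Bool) : patInd F S w ∈ lowDeg F ℓ S.card := by
  have h := prod_mem_lowDeg S (fun i _ => bitInd_mem_lowDeg (F := F) i (w i))
  rw [Nat.mul_one] at h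
  exact h

/-- restriction of `v` to `S` (zero elsewhere) -/
def restr (S : Finset (Fin ℓ)) (v : Fin ℓ → Bool) : Fin ℓ → Bool := fun i => if i ∈ S then v i else false

/-- **Junta expansion**: a function depending only on the coordinates in `S` is the sum of its values times the
pattern indicators of `S`. -/
theorem junta_eq_sum (S : Finset (Fin ℓ)) (f : CubeFn F ℓ)
    (hf : ∀ v w : Fin ℓ → Bool, (∀ i ∈ S, v i = w i) → f v = f w) :
    f = ∑ w ∈ (univ : Finset (Fin ℓ → Bool)).filter (fun w => ∀ i, i ∉ S → w i = false),
      f w • patInd F S w := by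
  funext v
  rw [Finset.sum_apply]
  simp only [Pi.smul_apply, smul_eq_mul, patInd_apply, mul_ite, mul_one, mul_zero]
  rw [Finset.sum_ite, Finset.sum_const_zero, add_zero]
  have hfilt : ((univ.filter fun w : Fin ℓ → Bool => ∀ i, i ∉ S → w i = false).filter
      fun w => ∀ i ∈ S, v i = w i) = {restr S v} := by
    ext w
    simp only [Finset.mem_filter, Finset.mem_univ, true_and, Finset.mem_singleton]
    constructor
    · rintro ⟨h1, h2⟩
      funext i
      by_cases hi : i ∈ S
      · simp only [restr, hi, if_true]
        exact (h2 i hi).symm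
      · simp only [restr, hi, if_false]
        exact h1 i hi
    · rintro rfl
      exact ⟨fun i hi => by simp [restr, hi], fun i hi => by simp [restr, hi]⟩
  rw [hfilt, Finset.sum_singleton]
  exact hf v (restr S v) (fun i hi => by simp [restr, hi])

/-- **JUNTA LEMMA**: a function of `v ∈ {0,1}^ℓ` depending only on the coordinates in `S` has degree `≤ #S`. -/
theorem junta_mem_lowDeg (S : Finset (Fin ℓ)) (f : CubeFn F ℓ)
    (hf : ∀ v w : Fin ℓ → Bool, (∀ i ∈ S, v i = w i) → f v = f w) : f ∈ lowDeg F ℓ S.card := by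
  rw [junta_eq_sum S f hf]
  exact Submodule.sum_mem _ fun w _ => Submodule.smul_mem _ _ (patInd_mem_lowDeg S w)

end Junta

/-! ### §14 The degree grade of a window and the FIBRE THEOREM (degree version, arbitrary tables, no modulus) -/

section Deg
variable {L ℓ R : ℕ} (c : ℕ) (y : Fin (L + ℓ + R + 1) → (Fin (L + ℓ + R) → Bool) → Bool)

/-- The fire indicator of cut `g` on the outside fibre `(a,b)` as an `𝔽₂`-valued function of the window content. -/
def fireFn (a : Fin L → Bool) (b : Fin R → Bool) (g : Fin (L + ℓ + R + 1)) : CubeFn (ZMod 2) ℓ :=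
  fun v => if y g (glue3 a v b) = true then 1 else 0

/-- **THE DEGREE GRADE.**  `DegLE y s`: on every outside fibre every selector, as a function `{0,1}^ℓ → 𝔽₂` of the window
content, has degree `≤ s`.  (Tables otherwise arbitrary; no modulus.) -/
def DegLE (s : ℕ) : Prop :=
  ∀ (g : Fin (L + ℓ + R + 1)) (a : Fin L → Bool) (b : Fin R → Bool), fireFn y a b g ∈ lowDeg (ZMod 2) ℓ s

/-- The class-`r` fire PARITY as an `𝔽₂`-valued cube function: `Σ_{g live at r} fire_g`. -/
def classPar (a : Fin L → Bool) (b : Fin R → Bool) (r : ℕ) : CubeFn (ZMod 2) ℓ :=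
  ∑ g ∈ univ.filter (fun g : Fin (L + ℓ + R + 1) => gapChar ℓ c a b g.val r % 3 ≠ 0), fireFn y a b g

/-- degree `≤ s` selectors ⟹ degree `≤ s` class parities -/
theorem classPar_mem_lowDeg {s : ℕ} (h : DegLE y s) (a : Fin L → Bool) (b : Fin R → Bool) (r : ℕ) :
    classPar c y a b r ∈ lowDeg (ZMod 2) ℓ s :=
  Submodule.sum_mem _ fun g _ => h g a b

/-- The class parity is the fire count [g24] read in `𝔽₂`. -/
theorem classPar_apply (a : Fin L → Bool) (b : Fin R → Bool) (r : ℕ) (v : Fin ℓ → Bool) :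
    classPar c y a b r v = ((fireCount c y a b r v : ℕ) : ZMod 2) := by
  unfold classPar fireCount
  rw [Finset.sum_apply]
  simp only [fireFn]
  rw [Finset.sum_boole]
  have hf : (univ.filter fun g : Fin (L + ℓ + R + 1) => gapChar ℓ c a b g.val r % 3 ≠ 0).filter
      (fun g => y g (glue3 a v b) = true) =
      univ.filter fun g : Fin (L + ℓ + R + 1) => y g (glue3 a v b) = true ∧ gapChar ℓ c a b g.val r % 3 ≠ 0 := by
    rw [Finset.filter_filter]
    exact Finset.filter_congr (fun g _ => and_comm)
  rw [hf]

/-- `classPar r v ≠ 0 ⟺ fireCount(r, v)` odd. -/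
theorem classPar_ne_zero_iff (a : Fin L → Bool) (b : Fin R → Bool) (r : ℕ) (v : Fin ℓ → Bool) :
    classPar c y a b r v ≠ 0 ↔ fireCount c y a b r v % 2 = 1 := by
  rw [classPar_apply, Ne, ZMod.natCast_eq_zero_iff]
  omega

/-- An abstract balance hypothesis at degree `s`, dimension `ℓ`, error `E`: the support of every degree-`≤ s` polynomial
`{0,1}^ℓ → 𝔽₂` carries at most a third of itself plus `E/3` in each residue class of `|v| mod 3`. -/
def ClassBalance (s ℓ : ℕ) (E : ℝ) : Prop :=
  ∀ g : CubeFn (ZMod 2) ℓ, g ∈ lowDeg (ZMod 2) ℓ s → ∀ r : ℕ,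
    (3 : ℝ) * (univ.filter fun v : Fin ℓ → Bool => g v ≠ 0 ∧ wt v % 3 = r % 3).card ≤
      (univ.filter fun v : Fin ℓ → Bool => g v ≠ 0).card + E

/-- **FIBRE THEOREM (degree version).**  On a cut-free window of degree grade `≤ s`, under a balance hypothesis with
error `E`: `3·#WIN ≤ 2·2^ℓ + 3E` on every outside fibre.  [uses only `sum_three_classes_le` [g24] from the cut structure] -/
theorem three_mul_win_fibre_le (hgap : CutFree y L ℓ) {s : ℕ} (hdeg : DegLE y s) {E : ℝ} (hbal : ClassBalance s ℓ E)
    (a : Fin L → Bool) (b : Fin R → Bool) :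
    (3 : ℝ) * (univ.filter fun v : Fin ℓ → Bool => ringWinU c y (glue3 a v b) = true).card ≤ 2 * 2 ^ ℓ + 3 * E := by
  rw [card_win_fibre_eq c y hgap a b]
  push_cast
  rw [Finset.mul_sum]
  have hclass : ∀ r ∈ range 3,
      (3 : ℝ) * ((univ.filter fun v : Fin ℓ → Bool => wt v % 3 = r ∧ fireCount c y a b r v % 2 = 1).card : ℝ) ≤
        ((univ.filter fun v : Fin ℓ → Bool => fireCount c y a b r v % 2 = 1).card : ℝ) + E := by
    intro r hr
    have hr3 : r % 3 = r := Nat.mod_eq_of_lt (Finset.mem_range.1 hr)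
    have h := hbal (classPar c y a b r) (classPar_mem_lowDeg c y hdeg a b r) r
    have e1 : (univ.filter fun v : Fin ℓ → Bool => classPar c y a b r v ≠ 0 ∧ wt v % 3 = r % 3) =
        univ.filter fun v : Fin ℓ → Bool => wt v % 3 = r ∧ fireCount c y a b r v % 2 = 1 := by
      refine Finset.filter_congr fun v _ => ?_
      rw [classPar_ne_zero_iff, hr3]
      exact and_comm
    have e2 : (univ.filter fun v : Fin ℓ → Bool => classPar c y a b r v ≠ 0) =
        univ.filter fun v : Fin ℓ → Bool => fireCount c y a b r v % 2 = 1 :=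
      Finset.filter_congr fun v _ => classPar_ne_zero_iff c y a b r v
    rw [e1, e2] at h
    exact h
  have hsum : (∑ r ∈ range 3, ((univ.filter fun v : Fin ℓ → Bool => fireCount c y a b r v % 2 = 1).card : ℝ)) ≤
      2 * 2 ^ ℓ := by
    have h := sum_three_classes_le c y a b
    have h' : ((∑ r ∈ range 3, (univ.filter fun v : Fin ℓ → Bool => fireCount c y a b r v % 2 = 1).card : ℕ) : ℝ)
        ≤ ((2 * 2 ^ ℓ : ℕ) : ℝ) := by exact_mod_cast h
    push_cast at h'
    exact h'
  calc ∑ r ∈ range 3, (3 : ℝ) * ((univ.filter fun v : Fin ℓ → Bool =>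
          wt v % 3 = r ∧ fireCount c y a b r v % 2 = 1).card : ℝ)
      ≤ ∑ r ∈ range 3, (((univ.filter fun v : Fin ℓ → Bool => fireCount c y a b r v % 2 = 1).card : ℝ) + E) :=
        Finset.sum_le_sum hclass
    _ = (∑ r ∈ range 3, ((univ.filter fun v : Fin ℓ → Bool => fireCount c y a b r v % 2 = 1).card : ℝ)) + 3 * E := by
        rw [Finset.sum_add_distrib, Finset.sum_const, Finset.card_range]
        simp
    _ ≤ 2 * 2 ^ ℓ + 3 * E := by linarith

/-- The tree's Viola–Wigderson balance [ViolaWigderson2008, Thm 2.9 at ζ = ω; tree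
`abs_three_mul_card_class_sub_card_support_le`] in `ClassBalance` form. -/
theorem classBalance_vw (s ℓ : ℕ) :
    ClassBalance s ℓ (1 + (2 : ℝ) ^ ℓ * Real.exp (-(3 * (ℓ : ℝ) / (8 * 4 ^ s)))) := by
  intro g hg r
  have h := abs_three_mul_card_class_sub_card_support_le g hg r
  have hwt : ∀ v : Fin ℓ → Bool, Hegedus.wt v = wt v := fun v => rfl
  simp only [hwt] at h
  have h' := (abs_le.1 h).2
  linarith

/-- **FIBRE THEOREM under an absorbed balance error**: `ClassBalance s ℓ E` with `4E ≤ 2^ℓ` ⟹ `12·#WIN ≤ 11·2^ℓ`. -/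
theorem twelve_mul_win_fibre_le_of_balance (hgap : CutFree y L ℓ) {s : ℕ} (hdeg : DegLE y s) {E : ℝ}
    (hbal : ClassBalance s ℓ E) (hE : 4 * E ≤ (2 : ℝ) ^ ℓ) (a : Fin L → Bool) (b : Fin R → Bool) :
    12 * (univ.filter fun v : Fin ℓ → Bool => ringWinU c y (glue3 a v b) = true).card ≤ 11 * 2 ^ ℓ := by
  have h3 := three_mul_win_fibre_le c y hgap hdeg hbal a b
  have h : (12 : ℝ) * ((univ.filter fun v : Fin ℓ → Bool => ringWinU c y (glue3 a v b) = true).card : ℝ) ≤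
      11 * (2 : ℝ) ^ ℓ := by linarith
  exact_mod_cast h

/-- **FIBRE THEOREM (Viola–Wigderson rung)**: cut-free window of degree grade `≤ s` with `4(s+2)·4^s ≤ ℓ` ⟹
`12·#WIN ≤ 11·2^ℓ` on every outside fibre — tables arbitrary, no modulus. -/
theorem twelve_mul_win_fibre_le (hgap : CutFree y L ℓ) {s : ℕ} (hdeg : DegLE y s) (hℓ : 4 * (s + 2) * 4 ^ s ≤ ℓ)
    (a : Fin L → Bool) (b : Fin R → Bool) :
    12 * (univ.filter fun v : Fin ℓ → Bool => ringWinU c y (glue3 a v b) = true).card ≤ 11 * 2 ^ ℓ := by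
  refine twelve_mul_win_fibre_le_of_balance c y hgap hdeg (classBalance_vw s ℓ) ?_ a b
  have hE := four_mul_one_add_err_le_two_pow hℓ
  have hpow : (2 : ℝ) ^ (ℓ - s) ≤ 2 ^ ℓ := pow_le_pow_right₀ (by norm_num) (Nat.sub_le ℓ s)
  linarith

end Deg

/-- **WINDOW THEOREM (degree version)**: Fubini over the outside fibres — `12·#WIN ≤ 11·2ⁿ`. -/
theorem window_bound_of_degLE (L ℓ R s : ℕ) (hℓ : 4 * (s + 2) * 4 ^ s ≤ ℓ) (c : ℕ)
    (y : Fin (L + ℓ + R + 1) → (Fin (L + ℓ + R) → Bool) → Bool) (hgap : CutFree y L ℓ) (hdeg : DegLE y s) :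
    12 * (univ.filter fun u : Fin (L + ℓ + R) → Bool => ringWinU c y u = true).card ≤ 11 * 2 ^ (L + ℓ + R) := by
  rw [card_filter_eq_sum_glue3 (fun w => ringWinU c y w = true), Finset.mul_sum]
  calc ∑ a : Fin L → Bool, 12 * ∑ b : Fin R → Bool,
        (univ.filter fun v : Fin ℓ → Bool => ringWinU c y (glue3 a v b) = true).card
      ≤ ∑ _a : Fin L → Bool, 2 ^ R * (11 * 2 ^ ℓ) := by
        refine Finset.sum_le_sum fun a _ => ?_
        rw [Finset.mul_sum]
        calc ∑ b : Fin R → Bool, 12 * (univ.filter fun v : Fin ℓ → Bool => ringWinU c y (glue3 a v b) = true).card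
            ≤ ∑ _b : Fin R → Bool, 11 * 2 ^ ℓ := Finset.sum_le_sum fun b _ => twelve_mul_win_fibre_le c y hgap hdeg hℓ a b
          _ = 2 ^ R * (11 * 2 ^ ℓ) := by
            rw [Finset.sum_const, Finset.card_univ, Fintype.card_fun, Fintype.card_bool, Fintype.card_fin,
              smul_eq_mul]
    _ = 2 ^ L * (2 ^ R * (11 * 2 ^ ℓ)) := by
        rw [Finset.sum_const, Finset.card_univ, Fintype.card_fun, Fintype.card_bool, Fintype.card_fin,
          smul_eq_mul]
    _ = 11 * 2 ^ (L + ℓ + R) := by rw [pow_add, pow_add]; ring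

/-- **PIECE `WindowDegSel`** (the degree grade, tables ARBITRARY, NO modulus): for every `s`, a strategy with a cut-free
window of degree grade `≤ s` and length `≥ ℓ₀(s)` wins on `≤ θ·2ⁿ` inputs.  [**PROVED**: `windowDegSel_holds`,
`θ = 11/12`, `ℓ₀ = 4(s+2)4^s`.] -/
def WindowDegSel : Prop :=
  ∀ s : ℕ, ∃ θ : ℝ, θ < 1 ∧ ∃ ℓ₀ : ℕ, ∀ L ℓ R : ℕ, ℓ₀ ≤ ℓ →
    ∀ (c : ℕ) (y : Fin (L + ℓ + R + 1) → (Fin (L + ℓ + R) → Bool) → Bool), CutFree y L ℓ → DegLE y s →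
      ((univ.filter fun u : Fin (L + ℓ + R) → Bool => ringWinU c y u = true).card : ℝ) ≤ θ * (2 : ℝ) ^ (L + ℓ + R)

/-- **THE DEGREE LAW IS A THEOREM** (every `s`; `θ = 11/12`). -/
theorem windowDegSel_holds : WindowDegSel := by
  intro s
  refine ⟨11 / 12, by norm_num, 4 * (s + 2) * 4 ^ s, fun L ℓ R hℓ c y hgap hdeg => ?_⟩
  have h := window_bound_of_degLE L ℓ R s hℓ c y hgap hdeg
  have h' : (12 : ℝ) * ((univ.filter fun u : Fin (L + ℓ + R) → Bool => ringWinU c y u = true).card : ℝ) ≤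
      11 * (2 : ℝ) ^ (L + ℓ + R) := by exact_mod_cast h
  linarith

end Summit.QuantumAdvantage.QuantumAdvantage.Theorems.RankDial

end
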